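/-
Origin: expansion seat `planner-pub-hodgecm-pv01-0`, handover 2026-08-18 (`HOME/pub-hodgecm-pv01/lean/Pv01/GaloisB3CM.lean`, md5 b96d212c, 140 lines);
landed by the gen-6 packager in gate run 22 as `HodgeCM/PerL34/GaloisB3CM.lean` (import ^import Pv01\.→import HodgeCM.PerL34. ×1).
-/
/-
Origin: planner-pub-hodgecm-pv01-0 (DAG-NODE PROVER #01), node N03, 2026-08-18. WIP path `Pv01/GaloisB3CM.lean`;
proposed landed path `HodgeCM/PerL34/GaloisB3CM.lean` (imports `Pv01.GaloisB3Field` → `HodgeCM.PerL34.GaloisB3Field`).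

# PerL Lemma 2.1(b) "`H' = H`" IN THE BINDERS OF `U.PerL`

`Geometry/Statements.lean` quantifies `U.PerL` over `(K L : CMField) (j : K →+* L)`, `IsNormalClosure ℚ K L`,
`finrank ℚ K = 6`, `finrank ℚ L = 24 ∨ 48`, an embedding `ι₁ : L →+* ℂ` and CM types `t i : CMType K` (subsets of
`K →+* ℂ` with `φ ∈ Φ ↔ conjugate φ ∉ Φ`).  In exactly these binders we prove the step of PerL v5 Lemma 2.1(b)
(tex ll. 160–166) that the paper imports from the NON-citable [Y1neg] Lemma 7.1(b):

  for a CM type `Φ` of `K` with `ι₁ ∘ j ∈ Φ`, the right stabiliser in `𝒢 = Gal(L/ℚ)` of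
  `\widetilde Φ := {g ∈ 𝒢 : g|_K ∈ Φ}` (where `g|_K := ι₁ ∘ g ∘ j ∈ Hom(K, ℂ)`) is `H := Gal(L/jK)`;

hence `L^{H'} = L^{H} = jK ≅ K` ("the reflex field of `(K, Φ)` is `K` itself", given Shimura–Taniyama's
`K* = L^{H'}`, PerL l. 162).  Also: `jK` has no quadratic subfield (§1.2 l. 49) and `|H| ∈ {4, 8}`.
Everything about complex conjugation (`c` central of order two, moving every embedding) is DERIVED from
Mathlib's `NumberField.IsCMField` (file `GaloisB3Field`, section `CM`); the group theory is `GaloisB3` /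
`GaloisB3Abstract`.  No internal statement is cited; no hypothesis beyond the binders of `U.PerL` remains.
-/
import Mathlib
import Summits.HodgeConjecture.HodgeCM.CM.Basic
import Summits.HodgeConjecture.HodgeCM.PerL34.GaloisB3Field_2

/-! PORT of `HodgeCM/PerL34/GaloisB3CM.lean` (HodgeCMPerL run 82) — verbatim mechanical port; provenance in the PORT header line. -/

namespace HodgeCM
namespace PerL34
namespace GaloisB3

open HodgeCM.Prior.ReflexLemma.RfwfReflex NumberField
open Literature.AlgebraicGeometry.Motives (CMType)

section PerLBinders

variable (K L : CMField) (j : K →+* L)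

/-- PerL's `j : K ↪ L` as a `ℚ`-algebra embedding (the base point `ψ₀` of `Hom_ℚ(K, L)`). -/
noncomputable def jQ : K →ₐ[ℚ] L := j.toRatAlgHom

/-- (Ported verbatim from the HodgeCMPerL package; no docstring in the source.) -/
@[simp] theorem jQ_coe : ((jQ K L j : K →ₐ[ℚ] L) : K →+* L) = j := RingHom.toRatAlgHom_toRingHom j

/-- (Ported verbatim from the HodgeCMPerL package; no docstring in the source.) -/
theorem jQ_apply (k : K) : jQ K L j k = j k := RingHom.toRatAlgHom_apply j k

/-- `H := Gal(L/jK)`, the subgroup of `Gal(L/ℚ)` fixing `j(K)` pointwise. -/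
noncomputable def galH : Subgroup (L ≃ₐ[ℚ] L) := (jQ K L j).fieldRange.fixingSubgroup

/-- (Ported verbatim from the HodgeCMPerL package; no docstring in the source.) -/
theorem mem_galH (g : L ≃ₐ[ℚ] L) : g ∈ galH K L j ↔ ∀ k : K, g (j k) = j k := by
  rw [galH, ← stabilizer_eq_fixingSubgroup, MulAction.mem_stabilizer_iff]
  constructor
  · intro h k
    have := AlgHom.congr_fun h k
    rwa [emb_smul_apply', jQ_apply] at this
  · intro h
    apply AlgHom.ext
    intro k
    rw [emb_smul_apply', jQ_apply]
    exact h k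

/-- A CM type `Φ ⊂ Hom(K, ℂ)` read in `L` through `ι₁`: the embeddings `ψ : K → L` with `ι₁ ∘ ψ ∈ Φ`. -/
noncomputable def typeInL (ι₁ : L →+* ℂ) (Φ : CMType K) : Finset (K →ₐ[ℚ] L) := by
  classical
  exact Finset.univ.filter (fun ψ : K →ₐ[ℚ] L => ι₁.comp (ψ : K →+* L) ∈ Φ.1)

/-- (Ported verbatim from the HodgeCMPerL package; no docstring in the source.) -/
theorem mem_typeInL (ι₁ : L →+* ℂ) (Φ : CMType K) (ψ : K →ₐ[ℚ] L) :
    ψ ∈ typeInL K L ι₁ Φ ↔ ι₁.comp (ψ : K →+* L) ∈ Φ.1 := by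
  classical
  simp [typeInL]

/-- Complex conjugation of `L` becomes complex conjugation of `ℂ` under ANY embedding `ι₁ : L → ℂ`:
`ι₁ ∘ (c ∘ ψ) = \overline{ι₁ ∘ ψ}`. -/
theorem comp_conjL_smul (ι₁ : L →+* ℂ) (ψ : K →ₐ[ℚ] L) :
    ι₁.comp ((((conjL : L ≃ₐ[ℚ] L) • ψ : K →ₐ[ℚ] L)) : K →+* L) =
      ComplexEmbedding.conjugate (ι₁.comp (ψ : K →+* L)) := by
  ext k
  rw [RingHom.coe_comp, Function.comp_apply, ComplexEmbedding.conjugate_coe_eq, RingHom.coe_comp,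
    Function.comp_apply]
  show ι₁ (((conjL : L ≃ₐ[ℚ] L) • ψ) k) = _
  rw [emb_smul_apply', conjL_apply]
  exact IsCMField.complexEmbedding_complexConj L ι₁ (ψ k)

/-- The CM-type axiom transported to `L`: `ψ ∈ Φ_L ↔ c ∘ ψ ∉ Φ_L`. -/
theorem typeInL_isCMType (ι₁ : L →+* ℂ) (Φ : CMType K) (ψ : K →ₐ[ℚ] L) :
    ψ ∈ typeInL K L ι₁ Φ ↔ (conjL : L ≃ₐ[ℚ] L) • ψ ∉ typeInL K L ι₁ Φ := by
  rw [mem_typeInL, mem_typeInL, comp_conjL_smul]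
  exact Φ.2 _

/-- `\widetilde Φ` in PerL's notation: `{g ∈ Gal(L/ℚ) : g|_K ∈ Φ}` with `g|_K := ι₁ ∘ g ∘ j`. -/
theorem mem_tilde_iff (ι₁ : L →+* ℂ) (Φ : CMType K) (g : L ≃ₐ[ℚ] L) :
    g ∈ {g : L ≃ₐ[ℚ] L | g • jQ K L j ∈ typeInL K L ι₁ Φ} ↔ ι₁.comp ((g : L →+* L).comp j) ∈ Φ.1 := by
  rw [Set.mem_setOf_eq, mem_typeInL, emb_smul_coe', jQ_coe]

/-- **PerL v5 Lemma 2.1(b), the `H' = H` step, in the binders of `U.PerL`.**  For CM fields `K`, `L` with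
`j : K ↪ L`, `L` a normal closure of `K`, `[K:ℚ] = 6`, `[L:ℚ] ∈ {24, 48}`, `ι₁ : L ↪ ℂ`, and a CM type `Φ` of
`K` containing `ι₁ ∘ j`: the right stabiliser of `\widetilde Φ = {g : ι₁ ∘ g ∘ j ∈ Φ}` in `Gal(L/ℚ)` is
`H = Gal(L/jK)`.  (PerL imports this from [Y1neg] Lemma 7.1(b); here it is a theorem.) -/
theorem perL_rightStab_tilde_eq_H [IsNormalClosure ℚ K L]
    (hK : Module.finrank ℚ K = 6) (hL : Module.finrank ℚ L = 24 ∨ Module.finrank ℚ L = 48)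
    (ι₁ : L →+* ℂ) (Φ : CMType K) (h1 : ι₁.comp j ∈ Φ.1) :
    rightStab {g : L ≃ₐ[ℚ] L | ι₁.comp ((g : L →+* L).comp j) ∈ Φ.1} = galH K L j := by
  have h0 : jQ K L j ∈ typeInL K L ι₁ Φ := by rw [mem_typeInL, jQ_coe]; exact h1
  have key := rightStab_eq_gal_emb (L := L) hK hL (typeInL K L ι₁ Φ) (typeInL_isCMType K L ι₁ Φ)
    (jQ K L j) h0
  have hset : {g : L ≃ₐ[ℚ] L | ι₁.comp ((g : L →+* L).comp j) ∈ Φ.1} =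
      {g : L ≃ₐ[ℚ] L | g • jQ K L j ∈ typeInL K L ι₁ Φ} := by
    ext g
    rw [Set.mem_setOf_eq, ← mem_tilde_iff K L j ι₁ Φ g]
  rw [hset, key]
  rfl

/-- Membership form: `u` right-stabilises `\widetilde Φ` iff `u` fixes `j(K)` pointwise. -/
theorem perL_rightStab_tilde_iff [IsNormalClosure ℚ K L]
    (hK : Module.finrank ℚ K = 6) (hL : Module.finrank ℚ L = 24 ∨ Module.finrank ℚ L = 48)
    (ι₁ : L →+* ℂ) (Φ : CMType K) (h1 : ι₁.comp j ∈ Φ.1) (u : L ≃ₐ[ℚ] L) :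
    u ∈ rightStab {g : L ≃ₐ[ℚ] L | ι₁.comp ((g : L →+* L).comp j) ∈ Φ.1} ↔ ∀ k : K, u (j k) = j k := by
  rw [perL_rightStab_tilde_eq_H K L j hK hL ι₁ Φ h1, mem_galH]

/-- **PerL §1.2 l. 49 "`K` contains no imaginary quadratic field"** in the binders of `U.PerL`: `j(K)` has no
subfield of degree `2` over `ℚ`. -/
theorem perL_no_quadratic_subfield [IsNormalClosure ℚ K L]
    (hK : Module.finrank ℚ K = 6) (hL : Module.finrank ℚ L = 24 ∨ Module.finrank ℚ L = 48)
    (E : IntermediateField ℚ L) (hEK : ∀ x ∈ E, ∃ k : K, j k = x) (hE : Module.finrank ℚ E = 2) : False := by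
  refine no_quadratic_subfield_emb' (L := L) hK hL (jQ K L j) E ?_ hE
  intro x hx
  obtain ⟨k, hk⟩ := hEK x hx
  exact AlgHom.mem_fieldRange.mpr ⟨k, by rw [jQ_apply, hk]⟩

/-- **PerL §1.2 l. 49 "|H| = 4 resp. 8"** in the binders of `U.PerL`. -/
theorem perL_card_H [IsNormalClosure ℚ K L]
    (hK : Module.finrank ℚ K = 6) (hL : Module.finrank ℚ L = 24 ∨ Module.finrank ℚ L = 48) :
    Nat.card (galH K L j) = 4 ∨ Nat.card (galH K L j) = 8 := by
  haveI := isGalois_of_isNormalClosure' (L := L) K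
  exact card_fixingSubgroup_emb hK hL (jQ K L j)

/-- **PerL l. 47 "complex conjugation is central in `𝒢`"** for the bundled CM field `L` (re-export). -/
theorem perL_conj_central (g : L ≃ₐ[ℚ] L) : (conjL : L ≃ₐ[ℚ] L) * g = g * conjL := conjL_central g

end PerLBinders

end GaloisB3
end PerL34
end HodgeCM
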